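import Literature.AnabelianGeometry.EtaleTheta.Thm16SubdagTransport
import Literature.AnabelianGeometry.EtaleTheta.Discharge.Sec2ThetaOrbitClasses
import HarnessLib

/-!
# [EtTh] Theorem 1.6 (iii) — sub-DAG row L13 «it is a tautology that γ is compatible with the symbols log(Θ)»:
# the transported theta class LIFTS to `H¹((Π^tp_Ÿβ)^Θ, Δ_Θ)` with restriction `log(Θ)` (proof-only)

Mochizuki, *The étale theta function and its Frobenioid-theoretic manifestations*, Publ. RIMS **45** (2009),
Thm. 1.6 (iii), proof, PRIMS PDF p. 25 l.20–21: "it is a tautology that `γ` is compatible with the symbols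
“log(Θ)” of Proposition 1.5, (i), (ii)"; Prop. 1.5 (iii) p. 23 ("arises from a unique class
`η̈^Θ ∈ H¹((Π^tp_Ÿ)^Θ, Δ_Θ)` that maps to log(Θ) in the quotient `F̈⁰/F̈¹`") [cite: MochizukiEtTh2009, Thm 1.6 (iii) p.25].

abc-iut cell, layer L2, sub-DAG `plan/L2/SUBDAG-EtTh-Thm16.md` (§K row K3; lineage abc-iut-L6-d5, ONE WRITER),
PART 8 — PROOF-ONLY. The capstone `Thm16Sub.thm16iii_of_printShapedInputs` (part 7) takes as binders a Θ-level
class `x′ ∈ H¹((Π^tp_{Ÿβ})^Θ, Δ_Θ)` inflating to the transported class `transport(η̈^Θ_α)` together with (half of)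
`hres`: its restriction to `Δ_Θ` is `log(Θ)`. THIS FILE supplies them: `Thm16Sub.exists_thetaLift_transport` — if
`x′α` lifts `x` on the α side with restriction `log(Θ)α` (Prop. 1.5 (iii) for `η̈^Θ_α`), then SOME class
`z′ ∈ H¹((Π^tp_{Ÿβ})^Θ, Δ_Θ)` inflates to `transport c h x` and restricts to `log(Θ)β`. Construction inside the
proof (no definition is introduced): the cocycle `z ↦ γ^Θ(f(γ^Θ⁻¹ z))` on `(Π^tp_{Ÿβ})^Θ`, for a cocycle `f`
representing `x′α` — well defined because `γ^Θ` carries `(Π^tp_{Ÿα})^Θ` onto `(Π^tp_{Ÿβ})^Θ` (Thm 1.6 (i) + the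
companion square `(·)^Θ ∘ γ = γ^Θ ∘ (·)^Θ`) and `(Δ_Θ)α` onto `(Δ_Θ)β`; its inflation is the transported cocycle
on the nose; and since `f` restricted to the commutative group `Δ_Θ` IS the identity as soon as its class is
`log(Θ)` (coboundaries of `Δ_Θ` with values in `Δ_Θ` vanish), the new cocycle restricts to the identity of
`(Δ_Θ)β`, i.e. to `log(Θ)β` — print's "tautology". Also `Thm16Sub.exists_thetaLift_transport_etaDd` (the case
`x = η̈^Θ_α`, lift from `Prop15iii`). No `def`, no new `Prop`; [EtTh] is refereed and undisputed; nothing here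
bears on [IUTchIII] Cor. 3.12; typed ≠ proved.
-/

noncomputable section

namespace Literature.AnabelianGeometry.EtaleTheta

open Literature.AnabelianGeometry.SemiGraphs

namespace Thm16Sub

variable {p : ℕ} [Fact p.Prime] {Dα Dβ : ThetaSetting p} {γ : Dα.PiTemp ≃ₜ* Dβ.PiTemp}

/-- `γ^Θ⁻¹ ∘ (·)^Θ_β = (·)^Θ_α ∘ γ⁻¹` (the companion square read backwards).
[cite: MochizukiEtTh2009, Thm 1.6 (ii) p.24] -/
theorem thetaIso_symm_toTheta (c : ThetaSetting.ThetaCompanion γ) (x : Dβ.PiTemp) :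
    c.thetaIso.toMulEquiv.symm (Dβ.toTheta x) = Dα.toTheta (γ.toMulEquiv.symm x) := by
  apply c.thetaIso.toMulEquiv.injective
  rw [MulEquiv.apply_symm_apply, ← c.comm, MulEquiv.apply_symm_apply]

/-- `γ^Θ⁻¹` carries `(Π^tp_{Ÿβ})^Θ` into `(Π^tp_{Ÿα})^Θ` (Thm 1.6 (i) + the companion square).
[cite: MochizukiEtTh2009, Thm 1.6 (i) p.24] -/
theorem thetaIso_symm_mem_GtpYddTheta (h : ThetaSetting.Thm16i γ) (c : ThetaSetting.ThetaCompanion γ)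
    {z : Dβ.GtpTheta} (hz : z ∈ Dβ.GtpYdd.map Dβ.toTheta) :
    c.thetaIso.toMulEquiv.symm z ∈ Dα.GtpYdd.map Dα.toTheta := by
  obtain ⟨y, hy, rfl⟩ := hz
  exact ⟨γ.toMulEquiv.symm y, ThetaSetting.symm_mem_GtpYdd h ⟨y, hy⟩,
    (thetaIso_symm_toTheta c y).symm⟩

/-- `γ^Θ⁻¹` carries `(Δ_Θ)β` into `(Δ_Θ)α`. [cite: MochizukiEtTh2009, Thm 1.6 (ii) p.24] -/
theorem thetaIso_symm_mem_deltaTheta (c : ThetaSetting.ThetaCompanion γ) {d : Dβ.GtpTheta}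
    (hd : d ∈ Dβ.DeltaTheta) : c.thetaIso.toMulEquiv.symm d ∈ Dα.DeltaTheta := by
  have hd' : d ∈ Dα.DeltaTheta.map c.thetaIso.toMulEquiv.toMonoidHom := by rw [c.map_deltaTheta]; exact hd
  obtain ⟨e, he, rfl⟩ := hd'
  change c.thetaIso.toMulEquiv.symm (c.thetaIso.toMulEquiv e) ∈ Dα.DeltaTheta
  rw [MulEquiv.symm_apply_apply]
  exact he

/-- A cocycle on `H ⊇ Δ_Θ` whose class restricts to `log(Θ)` IS the identity on `Δ_Θ`: coboundaries of the
commutative group `Δ_Θ` with values in `Δ_Θ` (conjugation action) vanish. [cite: MochizukiEtTh2009, Prop 1.5 (i) p.23] -/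
theorem cocycle_apply_eq_self_of_res_eq_logTheta {D : ThetaSetting p} {H : Subgroup D.GtpTheta}
    (hΔ : D.DeltaTheta ≤ H)
    (f : contCocycles (MonoidHom.id D.GtpTheta) D.DeltaTheta H)
    (hf : ContH1.res (MonoidHom.id D.GtpTheta) D.DeltaTheta hΔ (QuotientGroup.mk f) = D.logTheta)
    (k : D.DeltaTheta) : f.1 ⟨k.1, hΔ k.2⟩ = k := by
  have hid : (fun x : D.DeltaTheta => x) ∈
      contCocycles (MonoidHom.id D.GtpTheta) D.DeltaTheta D.DeltaTheta :=
    ⟨continuous_id, fun g g' => by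
      apply Subtype.ext
      simp only [Subgroup.coe_mul, MulAut.conjNormal_apply, MonoidHom.id_apply]
      conv_rhs => rw [← D.ker_thetaToEll_comm g'.1 g'.2 g.1 g.2]
      simp only [mul_inv_cancel_right]⟩
  have hlog : D.logTheta = QuotientGroup.mk (⟨fun x => x, hid⟩ :
      contCocycles (MonoidHom.id D.GtpTheta) D.DeltaTheta D.DeltaTheta) := rfl
  have hres : (QuotientGroup.mk (ContH1.resCocycle (MonoidHom.id D.GtpTheta) D.DeltaTheta hΔ f) :
      D.H1Theta D.DeltaTheta) = QuotientGroup.mk ⟨fun x => x, hid⟩ := by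
    rw [← hlog, ← hf]; rfl
  obtain ⟨a, ha⟩ := ContH1.exists_coboundary_of_mk_eq _ _ hres
  have hk := ha k
  -- the coboundary term `k a k⁻¹ a⁻¹` vanishes in the commutative group `Δ_Θ`
  have hcob : MulAut.conjNormal ((MonoidHom.id D.GtpTheta) (k : D.GtpTheta)) a * a⁻¹ = 1 := by
    rw [mul_inv_eq_one]
    apply Subtype.ext
    simp only [MulAut.conjNormal_apply, MonoidHom.id_apply]
    rw [D.ker_thetaToEll_comm k.1 k.2 a.1 a.2, mul_inv_cancel_right]
  rw [hcob, mul_one] at hk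
  exact hk.symm

/-- **Row L13 — the transported class lifts to `H¹((Π^tp_{Ÿβ})^Θ, Δ_Θ)` with restriction `log(Θ)`** ("it is a
tautology that `γ` is compatible with the symbols log(Θ)", p. 25): if `x′` lifts `x ∈ H¹(Π^tp_{Ÿα}, (Δ_Θ)α)` to
`H¹((Π^tp_{Ÿα})^Θ, Δ_Θ)` with restriction `log(Θ)α` to `(Δ_Θ)α`, then some `z′ ∈ H¹((Π^tp_{Ÿβ})^Θ, Δ_Θ)` inflates
to `transport(x)` and restricts to `log(Θ)β` — the `x′`-binders (and the `x′`-half of `hres`) of the capstone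
`thm16iii_of_printShapedInputs`. The witness is the class of `z ↦ γ^Θ(f(γ^Θ⁻¹ z))` for a cocycle `f` of `x′`
(built inside this proof; no definition). [cite: MochizukiEtTh2009, Thm 1.6 (iii) p.25] -/
theorem exists_thetaLift_transport (h : ThetaSetting.Thm16i γ) (c : ThetaSetting.ThetaCompanion γ)
    (hCα : Dα.Compat) (hCβ : Dβ.Compat) {x : Dα.H1 Dα.GtpYdd}
    {x' : Dα.H1Theta (Dα.GtpYdd.map Dα.toTheta)} (hx' : Dα.inflTheta Dα.GtpYdd x' = x)
    (hres : ContH1.res (MonoidHom.id Dα.GtpTheta) Dα.DeltaTheta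
        (hCα.deltaTheta_le_DtpYddTheta.trans (Subgroup.map_mono inf_le_left)) x' = Dα.logTheta) :
    ∃ z' : Dβ.H1Theta (Dβ.GtpYdd.map Dβ.toTheta),
      Dβ.inflTheta Dβ.GtpYdd z' = ThetaSetting.transport c h x ∧
      ContH1.res (MonoidHom.id Dβ.GtpTheta) Dβ.DeltaTheta
        (hCβ.deltaTheta_le_DtpYddTheta.trans (Subgroup.map_mono inf_le_left)) z' = Dβ.logTheta := by
  subst hx'
  obtain ⟨f, rfl⟩ := QuotientGroup.mk_surjective x'
  -- the Θ-level transported cocycle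
  set θ := c.thetaIso.toMulEquiv with hθ
  have hθc : Continuous fun z : Dβ.GtpTheta => θ.symm z := c.thetaIso.continuous_invFun
  let g : ↥(Dβ.GtpYdd.map Dβ.toTheta) → ↥Dβ.DeltaTheta := fun z =>
    ⟨θ (f.1 ⟨θ.symm z.1, thetaIso_symm_mem_GtpYddTheta h c z.2⟩).1, c.apply_mem _⟩
  have hg_apply : ∀ z : ↥(Dβ.GtpYdd.map Dβ.toTheta),
      ((g z : Dβ.DeltaTheta) : Dβ.GtpTheta) =
        θ (f.1 ⟨θ.symm z.1, thetaIso_symm_mem_GtpYddTheta h c z.2⟩).1 := fun z => rfl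
  have hg : g ∈ contCocycles (MonoidHom.id Dβ.GtpTheta) Dβ.DeltaTheta (Dβ.GtpYdd.map Dβ.toTheta) := by
    refine ⟨?_, fun z w => ?_⟩
    · apply continuous_induced_rng.2
      change Continuous fun z : ↥(Dβ.GtpYdd.map Dβ.toTheta) =>
        (θ (f.1 ⟨θ.symm z.1, thetaIso_symm_mem_GtpYddTheta h c z.2⟩).1 : Dβ.GtpTheta)
      exact (map_continuous c.thetaIso).comp (continuous_subtype_val.comp (f.2.1.comp
        ((hθc.comp continuous_subtype_val).subtype_mk _)))
    · have hzw : (⟨θ.symm (z * w).1, thetaIso_symm_mem_GtpYddTheta h c (z * w).2⟩ :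
            ↥(Dα.GtpYdd.map Dα.toTheta)) =
          ⟨θ.symm z.1, thetaIso_symm_mem_GtpYddTheta h c z.2⟩ *
            ⟨θ.symm w.1, thetaIso_symm_mem_GtpYddTheta h c w.2⟩ := by
        apply Subtype.ext
        simp only [Subgroup.coe_mul, MulMemClass.mk_mul_mk, map_mul]
      apply Subtype.ext
      rw [Subgroup.coe_mul, hg_apply, hg_apply, hzw, f.2.2]
      simp only [Subgroup.coe_mul, MulAut.conjNormal_apply, MonoidHom.id_apply, map_mul, map_inv,
        MulEquiv.apply_symm_apply, hg_apply]
  refine ⟨QuotientGroup.mk ⟨g, hg⟩, ?_, ?_⟩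
  · -- inflation of `g` IS the transported cocycle
    change (QuotientGroup.mk (ContH1.inflCocycle Dβ.DeltaTheta Dβ.toTheta Dβ.continuous_toTheta le_rfl
        ⟨g, hg⟩) : Dβ.H1 Dβ.GtpYdd) =
      QuotientGroup.mk (ThetaSetting.transportCocycle c h
        (ContH1.inflCocycle Dα.DeltaTheta Dα.toTheta Dα.continuous_toTheta le_rfl f))
    congr 1
    apply Subtype.ext
    funext y
    apply Subtype.ext
    change ((g ⟨Dβ.toTheta y.1, _⟩ : Dβ.DeltaTheta) : Dβ.GtpTheta) =
      c.thetaIso (f.1 ⟨Dα.toTheta (γ.toMulEquiv.symm y.1), _⟩).1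
    rw [hg_apply]
    change θ (f.1 ⟨θ.symm (Dβ.toTheta y.1), _⟩).1 = θ (f.1 ⟨Dα.toTheta (γ.toMulEquiv.symm y.1), _⟩).1
    exact congrArg (fun u : ↥(Dα.GtpYdd.map Dα.toTheta) => θ (f.1 u).1)
      (Subtype.ext (thetaIso_symm_toTheta c y.1))
  · -- restriction of `g` to `(Δ_Θ)β` is the identity, because `f` is the identity on `(Δ_Θ)α`
    have hidβ : (fun x : Dβ.DeltaTheta => x) ∈
        contCocycles (MonoidHom.id Dβ.GtpTheta) Dβ.DeltaTheta Dβ.DeltaTheta :=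
      ⟨continuous_id, fun g₁ g₂ => by
        apply Subtype.ext
        simp only [Subgroup.coe_mul, MulAut.conjNormal_apply, MonoidHom.id_apply]
        conv_rhs => rw [← Dβ.ker_thetaToEll_comm g₂.1 g₂.2 g₁.1 g₁.2]
        simp only [mul_inv_cancel_right]⟩
    have hlogβ : Dβ.logTheta = QuotientGroup.mk (⟨fun x => x, hidβ⟩ :
        contCocycles (MonoidHom.id Dβ.GtpTheta) Dβ.DeltaTheta Dβ.DeltaTheta) := rfl
    rw [hlogβ]
    change (QuotientGroup.mk (ContH1.resCocycle (MonoidHom.id Dβ.GtpTheta) Dβ.DeltaTheta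
        (hCβ.deltaTheta_le_DtpYddTheta.trans (Subgroup.map_mono inf_le_left)) ⟨g, hg⟩) :
        Dβ.H1Theta Dβ.DeltaTheta) = _
    congr 1
    apply Subtype.ext
    funext d
    apply Subtype.ext
    change ((g ⟨d.1, _⟩ : Dβ.DeltaTheta) : Dβ.GtpTheta) = d.1
    rw [hg_apply]
    have hdα : θ.symm d.1 ∈ Dα.DeltaTheta := thetaIso_symm_mem_deltaTheta c d.2
    have hfix := cocycle_apply_eq_self_of_res_eq_logTheta
      (hCα.deltaTheta_le_DtpYddTheta.trans (Subgroup.map_mono inf_le_left)) f hres ⟨θ.symm d.1, hdα⟩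
    have hval : (f.1 ⟨θ.symm d.1, thetaIso_symm_mem_GtpYddTheta h c
        ((hCβ.deltaTheta_le_DtpYddTheta.trans (Subgroup.map_mono inf_le_left)) d.2)⟩).1 = θ.symm d.1 :=
      congrArg Subtype.val hfix
    change θ (f.1 ⟨θ.symm d.1, _⟩).1 = d.1
    rw [hval, MulEquiv.apply_symm_apply]

/-- **The `x′`-binders of the capstone exist**, for the theta class itself: with THE lift `x′α` of `η̈^Θ_α`
(Prop. 1.5 (iii) on the α side), some `z′ ∈ H¹((Π^tp_{Ÿβ})^Θ, Δ_Θ)` inflates to `transport(η̈^Θ_α)` and restricts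
to `log(Θ)β`. [cite: MochizukiEtTh2009, Thm 1.6 (iii) p.25] -/
theorem exists_thetaLift_transport_etaDd (h : ThetaSetting.Thm16i γ) (c : ThetaSetting.ThetaCompanion γ)
    (hCα : Dα.Compat) (hCβ : Dβ.Compat) (Eα : Dα.EtaleThetaData)
    (h15α : ThetaSetting.Prop15iii Eα hCα) :
    ∃ z' : Dβ.H1Theta (Dβ.GtpYdd.map Dβ.toTheta),
      Dβ.inflTheta Dβ.GtpYdd z' = ThetaSetting.transport c h Eα.etaDd ∧
      ContH1.res (MonoidHom.id Dβ.GtpTheta) Dβ.DeltaTheta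
        (hCβ.deltaTheta_le_DtpYddTheta.trans (Subgroup.map_mono inf_le_left)) z' = Dβ.logTheta := by
  obtain ⟨x', ⟨hx', hres, -⟩, -⟩ := h15α Eα.etaDd (ThetaSetting.EtaleThetaData.etaDd_mem_thetaClasses Eα)
  exact exists_thetaLift_transport h c hCα hCβ hx' hres

end Thm16Sub

end Literature.AnabelianGeometry.EtaleTheta

end
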